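import Mathlib
import Literature.Analysis.OperatorTheory.ContractiveDetComplexity
import Literature.Analysis.OperatorTheory.ContractiveDeterminantalRepresentations
import Summits.ValiantsHypothesis.ValiantsHypothesis.Theorems.ContractivityPricePriceOfContractivityStubFewColoursContent
import Summits.ValiantsHypothesis.ValiantsHypothesis.Theorems.ContractivityPricePriceOfContractivityStubFewColoursTrie
import Summits.ValiantsHypothesis.ValiantsHypothesis.Theorems.ContractivityPricePriceOfContractivityStubFewColoursAssembly
import HarnessLib

/-!
# Crux `PriceOfContractivity` (stmt-ValiantsHypothesis-10583), line `registered` (birth rev 11) —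
# stub `stub_stableLifting_fewColours` (Theorem A″: ♦ for at most `L + 1` colour classes)

Route `ValiantsHypothesis/ContractivityPrice`, crux K1
(`Summit.ValiantsHypothesis.ValiantsHypothesis.Theses.ContractivityPrice.PriceOfContractivity`).
The composing stub ♦ (`stub_stableLifting`) asks: a Sylvester pencil `1 + diag (X ∘ κ) · K₀` of
size `R ≤ 2 ^ L` whose determinant has no zero on the closed radius-2 polydisc is re-realised at
size `R₁ ≤ 2 ^ ((L+d)^d)` by a pencil all of whose `(k+1)`-principal minors have modulus
`≤ (2 ^ ((L+d)^d)) ^ (k+1)`.  This file proves its registered PARTIAL CASE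
`stub_stableLifting_fewColours` (Theorem A″, `Lines/birth-fewcolours.md` §1): colourings using at
most `L + 1` colours (classes of arbitrary sizes), unconditionally, `d = 3` — the final assembly of
the landed pieces `piece3_contentBounds` (W6a), `piece3_trie` (W4), `piece3_assembly` (W5).

**Proof.** `R = 0` is trivial (`R₁ = 0`).  Otherwise peel the colour `x` of row `0`: block-reindex
`Fin R ≃ Fin n ⊕ Fin t` (`x`-rows first, the `t` foreign rows coloured by `c`, which factors through
an injective enumeration `g : Fin f → σ` of the `f ≤ L` foreign colours), so the pencil determinant
is that of `[[A, B], [C, D]]` coloured `(x; c)` (`det_pencil_reindex`).  W6a writes it as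
`â + Σ_{β ≠ 0} p̂_β ∏_j X_{g j}^{β j}` over the box `β : Fin f → Fin (t+1)` with
`|a_m| ≤ 3 r^m`, `|p_{β,m}| ≤ 9 (t/2)^{|β|} r^m`, `r = (n+1)/2`.  The box minus `0` is a forest
(`par β` = decrement one nonzero coordinate, `rk β = |β|`, `col β = g (that coordinate)`,
`mon β = ∏_j X_{g j}^{β j}`), and with `τ = max 1 (t/2)`, `E_β = τ^{-|β|} p_β` (`|E_{β,m}| ≤ 9 r^m`)
W5 (fed with W4) realises `â + Σ_β Ê_β τ^{|β|} mon β = P` by a matrix on `Fin R ⊕ V` with entries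
`≤ 40 r + 10 τ ≤ 25 R + 30`.  Reindex to `Fin R₁`, `R₁ = R + |V| ≤ R + (R+1)^L`; a `(k+1)`-minor of
a matrix with entries `≤ E` is `≤ (k+1)! E^{k+1} ≤ (R₁ E)^{k+1}` (`Matrix.det_le`), and
`(R + (R+1)^L)(25 R + 30) ≤ 2^{(L+3)^3}`.  All folklore bookkeeping around the landed pieces.
-/

noncomputable section

-- `Summit.<Summit>.<Problem>` repeats `ValiantsHypothesis` by the tree's layout convention (D-0017).
set_option linter.dupNamespace false

namespace Summit.ValiantsHypothesis.ValiantsHypothesis.Theorems.PriceOfContractivity.FewColours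

open Matrix
open Literature.Analysis.OperatorTheory (det_pencil_reindex)

/-! ### Bookkeeping lemmas -/

/-- Size arithmetic for Theorem A″: `(R + (R+1)^L) (25 R + 30) ≤ 2 ^ ((L+3)^3)` whenever
`R ≤ 2 ^ L`. [folklore] -/
theorem fewColours_key_arith (L R : ℕ) (hR : R ≤ 2 ^ L) :
    (R + (R + 1) ^ L) * (25 * R + 30) ≤ 2 ^ ((L + 3) ^ 3) := by
  have hL : 1 ≤ 2 ^ L := Nat.one_le_two_pow
  have h1 : (R + 1) ^ L ≤ 2 ^ (L * (L + 1)) := by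
    calc (R + 1) ^ L ≤ (2 ^ (L + 1)) ^ L :=
          Nat.pow_le_pow_left (by rw [pow_succ]; omega) L
      _ = 2 ^ (L * (L + 1)) := by rw [← pow_mul, mul_comm]
  have h2 : R + (R + 1) ^ L ≤ 2 ^ (L * (L + 1) + 1) := by
    have : 2 ^ L ≤ 2 ^ (L * (L + 1)) :=
      Nat.pow_le_pow_right (by norm_num) (by nlinarith)
    rw [pow_succ]
    omega
  have h3 : 25 * R + 30 ≤ 2 ^ (L + 6) := by
    have : 2 ^ (L + 6) = 2 ^ L * 64 := by rw [pow_add]; norm_num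
    omega
  calc (R + (R + 1) ^ L) * (25 * R + 30) ≤ 2 ^ (L * (L + 1) + 1) * 2 ^ (L + 6) :=
        Nat.mul_le_mul h2 h3
    _ = 2 ^ (L * (L + 1) + 1 + (L + 6)) := (pow_add _ _ _).symm
    _ ≤ 2 ^ ((L + 3) ^ 3) := by
        refine Nat.pow_le_pow_right (by norm_num) ?_
        have : L * (L + 1) + 1 + (L + 6) + (L ^ 3 + 8 * L ^ 2 + 25 * L + 20) = (L + 3) ^ 3 := by
          ring
        omega

/-- Principal minors from entries: if all entries of `K` have modulus `≤ Eb` and `R₁ · Eb ≤ M`,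
then every `(k+1) × (k+1)` principal minor on distinct indices has modulus
`≤ (k+1)! Eb^(k+1) ≤ (R₁ Eb)^(k+1) ≤ M^(k+1)` (Leibniz, `Matrix.det_le`). [folklore]
-- adapted from `StableLifting.norm_det_submatrix_le_factorial` -/
theorem fewColours_norm_det_submatrix_le {R₁ k : ℕ} (K : Matrix (Fin R₁) (Fin R₁) ℂ) {Eb M : ℝ}
    (hEb : 0 ≤ Eb) (hK : ∀ i j, ‖K i j‖ ≤ Eb) (hM : (R₁ : ℝ) * Eb ≤ M)
    (w : Fin (k + 1) → Fin R₁) (hw : Function.Injective w) :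
    ‖(K.submatrix w w).det‖ ≤ M ^ (k + 1) := by
  have h := Matrix.det_le (A := K.submatrix w w) (abv := NormedField.toAbsoluteValue ℂ) (x := Eb)
    (fun i j => by simpa [NormedField.toAbsoluteValue] using hK (w i) (w j))
  have hk : k + 1 ≤ R₁ := by
    simpa [Fintype.card_fin] using Fintype.card_le_of_injective w hw
  have hfac : (Nat.factorial (k + 1) : ℝ) ≤ (R₁ : ℝ) ^ (k + 1) := by
    exact_mod_cast (Nat.factorial_le_pow _).trans (Nat.pow_le_pow_left hk _)
  have hM0 : 0 ≤ (R₁ : ℝ) * Eb := by positivity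
  calc ‖(K.submatrix w w).det‖ ≤ (Nat.factorial (k + 1) : ℝ) * Eb ^ (k + 1) := by
        simpa [NormedField.toAbsoluteValue, Fintype.card_fin, nsmul_eq_mul] using h
    _ ≤ (R₁ : ℝ) ^ (k + 1) * Eb ^ (k + 1) := by gcongr
    _ = ((R₁ : ℝ) * Eb) ^ (k + 1) := (mul_pow _ _ _).symm
    _ ≤ M ^ (k + 1) := pow_le_pow_left₀ hM0 hM _

/-- Block indexing by one colour: `Fin R ≃ Fin n ⊕ Fin t` with the `x`-coloured indices first and
the others enumerated by `c : Fin t → σ`, `c j ≠ x`, `n + t = R`. [folklore]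
-- adapted from `OneLargeClass.piece_a_blockIndex` -/
theorem fewColours_blockIndex {σ : Type} {R : ℕ} (κ : Fin R → σ) (x : σ) :
    ∃ (n t : ℕ) (e : Fin R ≃ Fin n ⊕ Fin t) (c : Fin t → σ),
      n + t = R ∧ (∀ j, c j ≠ x) ∧ ∀ i, κ (e.symm i) = Sum.elim (fun _ => x) c i := by
  classical
  let p : Fin R → Prop := fun i => κ i = x
  let eX : {i // p i} ≃ Fin (Fintype.card {i // p i}) := Fintype.equivFin _
  let eF : {i // ¬p i} ≃ Fin (Fintype.card {i // ¬p i}) := Fintype.equivFin _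
  let e : Fin R ≃ Fin (Fintype.card {i // p i}) ⊕ Fin (Fintype.card {i // ¬p i}) :=
    (Equiv.sumCompl p).symm.trans (eX.sumCongr eF)
  refine ⟨_, _, e, fun j => κ (eF.symm j), ?_, fun j => (eF.symm j).2, ?_⟩
  · have h := Fintype.card_congr e
    simpa [Fintype.card_sum, Fintype.card_fin] using h.symm
  rintro (i | j)
  · show κ (Equiv.sumCompl p ((eX.sumCongr eF).symm (Sum.inl i))) = x
    rw [Equiv.sumCongr_symm, Equiv.sumCongr_apply, Sum.map_inl, Equiv.sumCompl_apply_inl]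
    exact (eX.symm i).2
  · show κ (Equiv.sumCompl p ((eX.sumCongr eF).symm (Sum.inr j))) = κ (eF.symm j)
    rw [Equiv.sumCongr_symm, Equiv.sumCongr_apply, Sum.map_inr, Equiv.sumCompl_apply_inr]

/-- **The box forest.**  On the nonzero points `β` of the box `Fin f → Fin (t+1)` choose a nonzero
coordinate `last β`; the parent of `β` is `β` with that coordinate decremented (none if `|β| = 1`)
and its colour is `g (last β)`.  Then, with rank `|β| = Σ_j β j` and monomial `∏_j X_{g j}^{β j}`:
roots have rank `1` and monomial `X_{col}`, and a child has rank `rk parent + 1` and monomial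
`mon parent · X_{col child}` — the four axioms consumed by `piece3_assembly`. [folklore] -/
theorem fewColours_boxForest {σ : Type} {t f : ℕ} (g : Fin f → σ) :
    ∃ (par : {β : Fin f → Fin (t + 1) // β ≠ 0} → Option {β : Fin f → Fin (t + 1) // β ≠ 0})
      (col : {β : Fin f → Fin (t + 1) // β ≠ 0} → σ),
      (∀ w, par w = none → ∑ j, (w.1 j : ℕ) = 1) ∧
      (∀ v w, par w = some v → ∑ j, (w.1 j : ℕ) = ∑ j, (v.1 j : ℕ) + 1) ∧
      (∀ w, par w = none →
        ∏ j, (MvPolynomial.X (g j) : MvPolynomial σ ℂ) ^ (w.1 j : ℕ) = MvPolynomial.X (col w)) ∧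
      (∀ v w, par w = some v →
        ∏ j, (MvPolynomial.X (g j) : MvPolynomial σ ℂ) ^ (w.1 j : ℕ) =
          (∏ j, (MvPolynomial.X (g j) : MvPolynomial σ ℂ) ^ (v.1 j : ℕ)) *
            MvPolynomial.X (col w)) := by
  -- every node has a nonzero coordinate; choose one (`last`)
  have hex : ∀ β : {β : Fin f → Fin (t + 1) // β ≠ 0}, ∃ j, β.1 j ≠ 0 := fun β =>
    not_forall.mp fun h => β.2 (funext h)
  choose last hlast using hex
  have hlast1 : ∀ β : {β : Fin f → Fin (t + 1) // β ≠ 0}, 1 ≤ (β.1 (last β) : ℕ) := fun β =>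
    Nat.one_le_iff_ne_zero.mpr fun h => hlast β (Fin.ext h)
  -- splitting sums and products at one coordinate
  have hsum : ∀ (β : Fin f → Fin (t + 1)) (i : Fin f),
      ∑ j, (β j : ℕ) = (β i : ℕ) + ∑ j ∈ Finset.univ.erase i, (β j : ℕ) := fun β i =>
    (Finset.add_sum_erase _ (fun j => (β j : ℕ)) (Finset.mem_univ i)).symm
  have hprod : ∀ (β : Fin f → Fin (t + 1)) (i : Fin f),
      ∏ j, (MvPolynomial.X (g j) : MvPolynomial σ ℂ) ^ (β j : ℕ) =
        (MvPolynomial.X (g i) : MvPolynomial σ ℂ) ^ (β i : ℕ) *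
          ∏ j ∈ Finset.univ.erase i, (MvPolynomial.X (g j) : MvPolynomial σ ℂ) ^ (β j : ℕ) :=
    fun β i => (Finset.mul_prod_erase _
      (fun j => (MvPolynomial.X (g j) : MvPolynomial σ ℂ) ^ (β j : ℕ)) (Finset.mem_univ i)).symm
  -- the decrement at the chosen coordinate
  obtain ⟨dec, hdec⟩ : ∃ dec : {β : Fin f → Fin (t + 1) // β ≠ 0} → (Fin f → Fin (t + 1)),
      dec = fun β => Function.update β.1 (last β)
        ⟨(β.1 (last β) : ℕ) - 1, lt_of_le_of_lt (Nat.sub_le _ _) (β.1 (last β)).isLt⟩ :=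
    ⟨_, rfl⟩
  have hdec_last : ∀ β, (dec β (last β) : ℕ) = (β.1 (last β) : ℕ) - 1 := fun β => by
    simp [hdec]
  have hdec_ne : ∀ β j, j ≠ last β → dec β j = β.1 j := fun β j hj => by
    simp [hdec, Function.update_of_ne hj]
  have hdec_sum' : ∀ β, ∑ j ∈ Finset.univ.erase (last β), (dec β j : ℕ) =
      ∑ j ∈ Finset.univ.erase (last β), (β.1 j : ℕ) := fun β =>
    Finset.sum_congr rfl fun j hj => by rw [hdec_ne β j (Finset.ne_of_mem_erase hj)]
  have hdec_prod' : ∀ β,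
      ∏ j ∈ Finset.univ.erase (last β), (MvPolynomial.X (g j) : MvPolynomial σ ℂ) ^ (dec β j : ℕ) =
      ∏ j ∈ Finset.univ.erase (last β), (MvPolynomial.X (g j) : MvPolynomial σ ℂ) ^ (β.1 j : ℕ) :=
    fun β => Finset.prod_congr rfl fun j hj => by rw [hdec_ne β j (Finset.ne_of_mem_erase hj)]
  have hdec_sum : ∀ β, ∑ j, (β.1 j : ℕ) = ∑ j, (dec β j : ℕ) + 1 := by
    intro β
    rw [hsum β.1 (last β), hsum (dec β) (last β), hdec_last, hdec_sum' β]
    have := hlast1 β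
    omega
  have hdec_nz : ∀ β, ∑ j, (β.1 j : ℕ) ≠ 1 → dec β ≠ 0 := by
    intro β hβ h
    refine hβ ?_
    rw [hdec_sum β, h]
    simp
  -- the parent map and its two defining properties
  obtain ⟨par, hpar⟩ : ∃ par : {β : Fin f → Fin (t + 1) // β ≠ 0} →
      Option {β : Fin f → Fin (t + 1) // β ≠ 0},
      par = fun β => if h : ∑ j, (β.1 j : ℕ) = 1 then none else some ⟨dec β, hdec_nz β h⟩ :=
    ⟨_, rfl⟩
  have hnone : ∀ w, par w = none → ∑ j, (w.1 j : ℕ) = 1 := fun w hw => by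
    by_contra h
    rw [hpar] at hw; dsimp only at hw; rw [dif_neg h] at hw
    cases hw
  have hsome : ∀ v w, par w = some v → v.1 = dec w := fun v w hvw => by
    rw [hpar] at hvw; dsimp only at hvw
    by_cases h : ∑ j, (w.1 j : ℕ) = 1
    · rw [dif_pos h] at hvw
      cases hvw
    · rw [dif_neg h, Option.some_inj] at hvw
      rw [← hvw]
  refine ⟨par, fun β => g (last β), hnone, fun v w hvw => ?_, fun w hw => ?_, fun v w hvw => ?_⟩
  · rw [hsome v w hvw]
    exact hdec_sum w
  · have h := hnone w hw
    rw [hsum w.1 (last w)] at h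
    have hl : (w.1 (last w) : ℕ) = 1 := by have := hlast1 w; omega
    have hrest : ∑ j ∈ Finset.univ.erase (last w), (w.1 j : ℕ) = 0 := by omega
    rw [Finset.sum_eq_zero_iff] at hrest
    rw [hprod w.1 (last w), hl, pow_one,
      Finset.prod_eq_one fun j hj => by rw [hrest j hj, pow_zero], mul_one]
  · rw [hsome v w hvw, hprod w.1 (last w), hprod (dec w) (last w), hdec_last, hdec_prod' w]
    conv_lhs => rw [← Nat.sub_add_cancel (hlast1 w), pow_succ]
    ring

/-! ### The block form of Theorem A″ -/

/-- **Theorem A″ in block form.**  For the two-block pencil of `[[A, B], [C, D]]` (colour `x` on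
`Fin n`, `c` on `Fin t`, `c` factoring through an injective enumeration `g : Fin f → σ` of foreign
colours, all `≠ x`) whose determinant is zero-free on the closed radius-2 polydisc, and any
`N + 1 ≥ n + t`: the pencil determinant is re-realised on `Fin (N+1) ⊕ V`, `V` the nonzero points
of the box `Fin f → Fin (t+1)`, with all entries of modulus `≤ 20 (n+1) + 10 max (1, t/2)` — the
content expansion (`piece3_contentBounds`), the box forest, the rescaling `E_β = τ^{-|β|} p_β`
(`τ = max 1 (t/2)`, so `|E_{β,m}| ≤ 9 ((n+1)/2)^m`) and the forest assembly (`piece3_assembly` fed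
with `piece3_trie`). [folklore] -/
theorem fewColours_core {σ : Type} (x : σ) {n t f : ℕ} (c : Fin t → σ) (g : Fin f → σ)
    (idx : Fin t → Fin f) (hgc : ∀ i, g (idx i) = c i) (hgx : ∀ j, g j ≠ x)
    (hg : Function.Injective g) (N : ℕ) (hN : n + t ≤ N + 1)
    (A : Matrix (Fin n) (Fin n) ℂ) (B : Matrix (Fin n) (Fin t) ℂ) (C : Matrix (Fin t) (Fin n) ℂ)
    (D : Matrix (Fin t) (Fin t) ℂ)
    (hP : ∀ z : σ → ℂ, (∀ j, ‖z j‖ ≤ 2) →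
      MvPolynomial.eval z
        (1 + Matrix.diagonal (fun i => MvPolynomial.X (Sum.elim (fun _ => x) c i)) *
          (Matrix.fromBlocks A B C D).map
            (fun a : ℂ => (MvPolynomial.C a : MvPolynomial σ ℂ))).det ≠ 0) :
    ∃ (K₁ : Matrix (Fin (N + 1) ⊕ {β : Fin f → Fin (t + 1) // β ≠ 0})
        (Fin (N + 1) ⊕ {β : Fin f → Fin (t + 1) // β ≠ 0}) ℂ)
      (col : {β : Fin f → Fin (t + 1) // β ≠ 0} → σ),
      (∀ i j, ‖K₁ i j‖ ≤ 20 * ((n : ℝ) + 1) + 10 * max 1 ((t : ℝ) / 2)) ∧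
      (1 + Matrix.diagonal (fun i => MvPolynomial.X (Sum.elim (fun _ => x) c i)) *
          (Matrix.fromBlocks A B C D).map
            (fun a : ℂ => (MvPolynomial.C a : MvPolynomial σ ℂ))).det =
        (1 + Matrix.diagonal (fun i => MvPolynomial.X (Sum.elim (fun _ => x) col i)) *
          K₁.map (fun a : ℂ => (MvPolynomial.C a : MvPolynomial σ ℂ))).det := by
  obtain ⟨a, p, ha0, hadeg, hpdeg, hac, hpc, hPeq⟩ :=
    piece3_contentBounds x c g idx hgc hgx hg A B C D hP
  obtain ⟨par, col, hrk1, hrkS, hmon1, hmonS⟩ := fewColours_boxForest (σ := σ) (t := t) g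
  -- parameters
  set r : ℝ := ((n : ℝ) + 1) / 2 with hr_def
  set τ : ℝ := max 1 ((t : ℝ) / 2) with hτ_def
  have hr : 0 < r := by positivity
  have hτ : 1 ≤ τ := le_max_left _ _
  have hτ0 : 0 < τ := one_pos.trans_le hτ
  have hτc0 : (τ : ℂ) ≠ 0 := by exact_mod_cast hτ0.ne'
  -- the rescaled content family
  set E : {β : Fin f → Fin (t + 1) // β ≠ 0} → Polynomial ℂ := fun β =>
    Polynomial.C (((τ : ℂ))⁻¹ ^ (∑ j, (β.1 j : ℕ))) * p β with hE_def
  have hEdeg : ∀ β, (E β).natDegree ≤ N + 1 := fun β =>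
    (Polynomial.natDegree_C_mul_le _ _).trans ((hpdeg β).trans hN)
  have hac' : ∀ j : ℕ, ‖a.coeff (j + 1)‖ ≤ 3 * r * r ^ j := fun j => by
    rw [mul_assoc, ← pow_succ']
    exact hac (j + 1)
  have hEc : ∀ β (j : ℕ), ‖(E β).coeff j‖ ≤ 9 * r ^ j := by
    intro β j
    simp only [hE_def, Polynomial.coeff_C_mul, norm_mul, norm_pow, norm_inv, Complex.norm_real,
      Real.norm_eq_abs, abs_of_pos hτ0]
    have h1 : ((t : ℝ) / 2) / τ ≤ 1 := by
      rw [div_le_one hτ0]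
      exact le_max_right _ _
    have h0 : 0 ≤ ((t : ℝ) / 2) / τ := by positivity
    calc τ⁻¹ ^ (∑ j, (β.1 j : ℕ)) * ‖(p β).coeff j‖
        ≤ τ⁻¹ ^ (∑ j, (β.1 j : ℕ)) * (9 * ((t : ℝ) / 2) ^ (∑ j, (β.1 j : ℕ)) * r ^ j) := by
          gcongr
          exact hpc β j
      _ = 9 * (((t : ℝ) / 2) / τ) ^ (∑ j, (β.1 j : ℕ)) * r ^ j := by
          rw [div_eq_mul_inv _ τ, mul_pow]
          ring
      _ ≤ 9 * (1 : ℝ) ^ (∑ j, (β.1 j : ℕ)) * r ^ j := by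
          gcongr
      _ = 9 * r ^ j := by rw [one_pow, mul_one]
  obtain ⟨K₁, hK₁, hdet⟩ := piece3_assembly piece3_trie x par (fun β => ∑ j, (β.1 j : ℕ)) col
    (fun β => ∏ j, (MvPolynomial.X (g j) : MvPolynomial σ ℂ) ^ (β.1 j : ℕ)) hrk1 hrkS hmon1 hmonS
    N r τ (3 * r) 9 a E hr hτ (by positivity) (by norm_num) ha0 (hadeg.trans (by omega)) hEdeg
    hac' hEc
  refine ⟨K₁, col, fun i j => (hK₁ i j).trans (le_of_eq ?_), ?_⟩
  · rw [hr_def]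
    ring
  · rw [hPeq, hdet]
    congr 1
    refine Finset.sum_congr rfl fun β _ => ?_
    simp only [hE_def, map_mul, Polynomial.aeval_C, MvPolynomial.algebraMap_eq]
    symm
    rw [mul_mul_mul_comm, ← MvPolynomial.C_mul, ← mul_pow, inv_mul_cancel₀ hτc0, one_pow,
      MvPolynomial.C_1, one_mul]

/-! ### Theorem A″ -/

/-- **Theorem A″ (♦ for few colour classes).**  A Sylvester pencil `1 + diag (X ∘ κ) · K₀` of size
`R ≤ 2 ^ L` using at most `L + 1` colours, whose determinant has no zero on the closed polydisc
of radius `2`, is re-realised at size `R₁ ≤ 2 ^ ((L+3)^3)` by a pencil all of whose `(k+1)`-minors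
on distinct indices have modulus `≤ (2 ^ ((L+3)^3)) ^ (k+1)`: peel the colour of row `0`, expand
by colour content (`piece3_contentBounds`), realise on the box forest (`piece3_assembly`,
`piece3_trie`) with entries `≤ 25 R + 30`, reindex to `Fin (R + |V|)`, `|V| ≤ (R+1)^L`, and bound
minors by entries (`(k+1)! E^{k+1} ≤ (R₁ E)^{k+1}`, `(R + (R+1)^L)(25R + 30) ≤ 2^{(L+3)^3}`).
The registered partial case of ♦ with `d = 3`. [folklore around the landed pieces] -/
theorem stub_stableLifting_fewColours :
    ∃ d : ℕ, ∀ (L R : ℕ) {σ : Type} (K₀ : Matrix (Fin R) (Fin R) ℂ) (κ : Fin R → σ),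
      (∃ s : Finset σ, s.card ≤ L + 1 ∧ ∀ i, κ i ∈ s) →
      R ≤ 2 ^ L →
      (∀ z : σ → ℂ, (∀ j, ‖z j‖ ≤ 2) → MvPolynomial.eval z (1 + Matrix.diagonal (fun i => MvPolynomial.X (κ i)) * K₀.map (fun a : ℂ => (MvPolynomial.C a : MvPolynomial σ ℂ))).det ≠ 0) →
      ∃ R₁ ≤ 2 ^ ((L + d) ^ d), ∃ (K₁ : Matrix (Fin R₁) (Fin R₁) ℂ) (κ₁ : Fin R₁ → σ),
        (∀ (k : ℕ) (w : Fin (k + 1) → Fin R₁), Function.Injective w →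
          ‖(K₁.submatrix w w).det‖ ≤ ((2 : ℝ) ^ ((L + d) ^ d)) ^ (k + 1)) ∧
        (1 + Matrix.diagonal (fun i => MvPolynomial.X (κ i)) * K₀.map (fun a : ℂ => (MvPolynomial.C a : MvPolynomial σ ℂ))).det =
          (1 + Matrix.diagonal (fun i => MvPolynomial.X (κ₁ i)) * K₁.map (fun a : ℂ => (MvPolynomial.C a : MvPolynomial σ ℂ))).det := by
  classical
  refine ⟨3, ?_⟩
  rintro L (_ | N) σ K₀ κ ⟨s, hscard, hκs⟩ hR hz
  · -- `R = 0`: nothing to do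
    exact ⟨0, Nat.zero_le _, K₀, κ, fun k w _ => Fin.elim0 (w 0), rfl⟩
  -- `R = N + 1`: peel the colour of row `0`
  set x : σ := κ 0 with hx_def
  obtain ⟨n, t, e, c, hnt, hc, hκe⟩ := fewColours_blockIndex κ x
  have hxs : x ∈ s := hκs 0
  have hcs : ∀ i, c i ∈ s := fun i => by
    have h := hκs (e.symm (Sum.inr i))
    rwa [hκe] at h
  -- the foreign colours, enumerated injectively
  have hfL : (s.erase x).card ≤ L := by
    rw [Finset.card_erase_of_mem hxs]
    omega
  let g : Fin (s.erase x).card → σ := fun j => ((s.erase x).equivFin.symm j : σ)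
  have hg : Function.Injective g :=
    Subtype.val_injective.comp (s.erase x).equivFin.symm.injective
  have hgx : ∀ j, g j ≠ x := fun j => (Finset.mem_erase.mp ((s.erase x).equivFin.symm j).2).1
  let idx : Fin t → Fin (s.erase x).card := fun i =>
    (s.erase x).equivFin ⟨c i, Finset.mem_erase.mpr ⟨hc i, hcs i⟩⟩
  have hgc : ∀ i, g (idx i) = c i := fun i => by simp [g, idx]
  -- the block form of the pencil
  have hfun : (fun i => MvPolynomial.X (κ (e.symm i)) : Fin n ⊕ Fin t → MvPolynomial σ ℂ) =
      fun i => MvPolynomial.X (Sum.elim (fun _ => x) c i) := funext fun i => by rw [hκe i]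
  have hPdef : (1 + Matrix.diagonal (fun i => MvPolynomial.X (κ i)) *
        K₀.map (fun a : ℂ => (MvPolynomial.C a : MvPolynomial σ ℂ))).det =
      (1 + Matrix.diagonal (fun i => MvPolynomial.X (Sum.elim (fun _ => x) c i)) *
        (Matrix.fromBlocks (Matrix.reindex e e K₀).toBlocks₁₁ (Matrix.reindex e e K₀).toBlocks₁₂
          (Matrix.reindex e e K₀).toBlocks₂₁ (Matrix.reindex e e K₀).toBlocks₂₂).map
          (fun a : ℂ => (MvPolynomial.C a : MvPolynomial σ ℂ))).det := by
    rw [Matrix.fromBlocks_toBlocks, ← det_pencil_reindex e K₀ κ, hfun]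
  have hz' : ∀ z : σ → ℂ, (∀ j, ‖z j‖ ≤ 2) →
      MvPolynomial.eval z
        (1 + Matrix.diagonal (fun i => MvPolynomial.X (Sum.elim (fun _ => x) c i)) *
          (Matrix.fromBlocks (Matrix.reindex e e K₀).toBlocks₁₁ (Matrix.reindex e e K₀).toBlocks₁₂
            (Matrix.reindex e e K₀).toBlocks₂₁ (Matrix.reindex e e K₀).toBlocks₂₂).map
            (fun a : ℂ => (MvPolynomial.C a : MvPolynomial σ ℂ))).det ≠ 0 := by
    intro z hz2
    rw [← hPdef]
    exact hz z hz2
  obtain ⟨K₁, col, hK₁, hdet⟩ :=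
    fewColours_core x c g idx hgc hgx hg N (by omega) _ _ _ _ hz'
  -- reindex to `Fin R₁`, `R₁ = R + |V|`
  let e₁ : Fin (N + 1) ⊕ {β : Fin (s.erase x).card → Fin (t + 1) // β ≠ 0} ≃
      Fin (N + 1 + Fintype.card {β : Fin (s.erase x).card → Fin (t + 1) // β ≠ 0}) :=
    (Equiv.sumCongr (Equiv.refl _) (Fintype.equivFin _)).trans finSumFinEquiv
  -- sizes
  have hV : Fintype.card {β : Fin (s.erase x).card → Fin (t + 1) // β ≠ 0} ≤ (N + 1 + 1) ^ L := by
    calc Fintype.card {β : Fin (s.erase x).card → Fin (t + 1) // β ≠ 0}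
        ≤ Fintype.card (Fin (s.erase x).card → Fin (t + 1)) := Fintype.card_subtype_le _
      _ = (t + 1) ^ (s.erase x).card := by rw [Fintype.card_fun, Fintype.card_fin, Fintype.card_fin]
      _ ≤ (N + 1 + 1) ^ (s.erase x).card := Nat.pow_le_pow_left (by omega) _
      _ ≤ (N + 1 + 1) ^ L := Nat.pow_le_pow_right (by omega) hfL
  have hR₁ : N + 1 + Fintype.card {β : Fin (s.erase x).card → Fin (t + 1) // β ≠ 0} ≤
      N + 1 + (N + 1 + 1) ^ L := by omega
  have hkey := fewColours_key_arith L (N + 1) hR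
  refine ⟨N + 1 + Fintype.card {β : Fin (s.erase x).card → Fin (t + 1) // β ≠ 0}, ?_,
    Matrix.reindex e₁ e₁ K₁, fun i => Sum.elim (fun _ => x) col (e₁.symm i), ?_, ?_⟩
  · -- `R₁ ≤ 2 ^ ((L+3)^3)`
    exact hR₁.trans (le_trans (Nat.le_mul_of_pos_right _ (by omega)) hkey)
  · -- principal minors
    intro k w hw
    have hEb0 : (0 : ℝ) ≤ 20 * ((n : ℝ) + 1) + 10 * max 1 ((t : ℝ) / 2) := by positivity
    refine fewColours_norm_det_submatrix_le (Matrix.reindex e₁ e₁ K₁) hEb0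
      (fun i j => by
        rw [Matrix.reindex_apply, Matrix.submatrix_apply]
        exact hK₁ _ _) ?_ w hw
    have h1 : ((N + 1 + Fintype.card {β : Fin (s.erase x).card → Fin (t + 1) // β ≠ 0} : ℕ) : ℝ) ≤
        ((N + 1 + (N + 1 + 1) ^ L : ℕ) : ℝ) := by exact_mod_cast hR₁
    have hn : (n : ℝ) ≤ N + 1 := by exact_mod_cast (by omega : n ≤ N + 1)
    have ht : (t : ℝ) ≤ N + 1 := by exact_mod_cast (by omega : t ≤ N + 1)
    have hmax : max 1 ((t : ℝ) / 2) ≤ 1 + (t : ℝ) / 2 :=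
      max_le (by linarith [(Nat.cast_nonneg t : (0 : ℝ) ≤ t)]) (by linarith)
    have h2 : 20 * ((n : ℝ) + 1) + 10 * max 1 ((t : ℝ) / 2) ≤ ((25 * (N + 1) + 30 : ℕ) : ℝ) := by
      push_cast
      linarith
    calc ((N + 1 + Fintype.card {β : Fin (s.erase x).card → Fin (t + 1) // β ≠ 0} : ℕ) : ℝ) *
          (20 * ((n : ℝ) + 1) + 10 * max 1 ((t : ℝ) / 2))
        ≤ ((N + 1 + (N + 1 + 1) ^ L : ℕ) : ℝ) * ((25 * (N + 1) + 30 : ℕ) : ℝ) :=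
          mul_le_mul h1 h2 hEb0 (by positivity)
      _ = (((N + 1 + (N + 1 + 1) ^ L) * (25 * (N + 1) + 30) : ℕ) : ℝ) := by push_cast; ring
      _ ≤ ((2 ^ ((L + 3) ^ 3) : ℕ) : ℝ) := by exact_mod_cast hkey
      _ = (2 : ℝ) ^ ((L + 3) ^ 3) := by push_cast; ring
  · -- the pencil identity
    rw [hPdef, hdet, det_pencil_reindex]

end Summit.ValiantsHypothesis.ValiantsHypothesis.Theorems.PriceOfContractivity.FewColours
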